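import Mathlib
import HarnessLib
import Summits.Langlands.Langlands.Theses.ParityBlindBianchi
import Literature.NumberTheory.Automorphic.PairLFunctionNeConjOfArchAllPairs
import Literature.NumberTheory.Automorphic.ArchRankinSelbergTestVector
import Literature.NumberTheory.Automorphic.PairLFunctionEqConjOfArchAllPairs

/-!
# Stub `stub_mwEqConjGL2_of_testVector` of skeleton v5 (crux stmt-Langlands-16812, line `Sketch`)

Mœglin–Waldspurger (1989), Appendice, Corollaire (ii) for `GL₂ × GL₂` — `s (s - 1) L^S(s, π × π̃)` agrees
on `re s > 1` with an entire function, for every cuspidal `π` on `GL₂(𝔸_K)`, every finite `S` and honest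
Satake families (`MoeglinWaldspurger1989_partialPairL_of_eq_conj (n := 2)`) — from the Humphries–Jo
archimedean test-vector fact at rank `2`. The mathematics is the general-rank Literature theorem
`MoeglinWaldspurger1989_partialPairL_of_eq_conj_of_testVector` (`PairLFunctionEqConjOfArchAllPairs`: the
self-pair twin of the AllPairs Rankin–Selberg assembly — spread pair datum inside `π = σ̄` with a common
fixing test function from Harish-Chandra finiteness, thin test functions at the places of `S`, the
`S`-part a non-zero constant times `Ψ_∞`, and the residue-free per-pair reduction, `s (s - 1) I(s)` being
entire); this file applies it at `n = 2`. The multiplicity-one hypothesis of the registered signature is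
not needed.
-/

noncomputable section

open scoped BigOperators Topology Classical Matrix NumberField MatrixGroups
open Literature.NumberTheory.Automorphic Literature.NumberTheory.GaloisRepresentations
  IsDedekindDomain NumberField Filter MeasureTheory
open Literature.NumberTheory.Automorphic.AdelicGroupData

-- `Summit.Langlands.Langlands.…`: summit = sub-problem name (D-0017 nested layout), not a typo.
set_option linter.dupNamespace false

namespace Summit.Langlands.Langlands.Theorems.QuadraticBaseChangeGL2

/-- **Mœglin–Waldspurger (ii) for `GL₂ × GL₂` from the archimedean test vectors** (stub
`stub_mwEqConjGL2_of_testVector` of skeleton v5, discharged). Granted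
`HumphriesJo2024_archRankinSelberg_testVector 2 K` for all number fields `K` (and multiplicity one on
every `L²_cusp(GL₂(𝔸_K))`, which is not used), for every `K`, every automorphic measure `μ`, every
cuspidal `π = σ̄` in `L²_cusp(GL₂(𝔸_K), μ)`, every finite `S` and Satake families `α`, `β` off `S`,
`s (s - 1) L^S(s, π × σ)` agrees on `re s > 1` with an entire function: the general-rank theorem
`MoeglinWaldspurger1989_partialPairL_of_eq_conj_of_testVector` at `n = 2` (Cogdell (2004), §4.2,
Thm. 4.2; Jacquet–Shalika (1981), §4 for the global integral; Jacquet (1972), §19 for `GL₂`).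
[cite: MoeglinWaldspurger1989, Appendice, Corollaire (ii), p. 667] -/
theorem stub_mwEqConjGL2_of_testVector :
    (∀ (K : Type) [Field K] [NumberField K], HumphriesJo2024_archRankinSelberg_testVector 2 K) →
    (∀ (K : Type) [Field K] [NumberField K] (μ : Measure (gl 2 K).automorphicQuotient)
      [(gl 2 K).IsAutomorphicMeasure μ], multiplicity_one_gl 2 K μ) →
    ∀ (K : Type) [Field K] [NumberField K] (μ : Measure (gl 2 K).automorphicQuotient)
      [(gl 2 K).IsAutomorphicMeasure μ],
      @MoeglinWaldspurger1989_partialPairL_of_eq_conj 2 K _ _ μ _ := by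
  intro hHJ _ K _ _ μ _
  exact MoeglinWaldspurger1989_partialPairL_of_eq_conj_of_testVector (hHJ K)

end Summit.Langlands.Langlands.Theorems.QuadraticBaseChangeGL2

end
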